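import Summits.MatrixMultiplication.OmegaCensus.STPPVosperCoverEK1A1
import Summits.MatrixMultiplication.OmegaCensus.STPPVosperCoverEK1A2
import Summits.MatrixMultiplication.OmegaCensus.STPPVosperCoverEK1A3
import Summits.MatrixMultiplication.OmegaCensus.STPPVosperCoverEK1A4
import Summits.MatrixMultiplication.OmegaCensus.STPPVosperCoverEK1A5
import Summits.MatrixMultiplication.OmegaCensus.STPPVosperCoverEK1A6
import Summits.MatrixMultiplication.OmegaCensus.STPPVosperCoverEK1A7
import Summits.MatrixMultiplication.OmegaCensus.STPPVosperCoverEK1A8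
import Summits.MatrixMultiplication.OmegaCensus.STPPVosperSlackOneCoverStepsE
/-!
# ω-census (abelian STPP census): K1 `{(1,1,2),(2,2,3),(3,4,2)²} ⊄ ℤ₆₁` — assembly of the α₂ hypothesis (spec form) (kernel computations)

HONEST FRAMING (pub-omega census; verbatim): lottery ticket; floor = certified bounds/negative ranges.
Census STRUCTURE (seat pub-omega-stpp-1 gen 32, 2026-08-28), family (b2).  Assembles hypothesis `hspecα` of `no_isSTPP_of_slack_one_coverE_prime_a2` (`STPPVosperSlackOneCoverLawA2E.lean`, enumerator `blockDiffsWP 61`, Y-first) for the reading `(a,b,c) = (2,3,4)` of K1 (`(n+1, L, b, z) = (43, 17, 3, 16)`, word target `{0, ±1, ±2}`): for `j = 30, 31` and each `ℓ₁ ≤ 8` the four admissible offsets (`alpha2AdmOKd`, stpp-2 `STPPVosperSlackOneCoverStepsWd.lean`) have failing searches (`STPPVosperCoverEK1A1–8.lean`); every other ratio is a word or has no admissible offset (`admbulkK1`).  Pattern of stpp-2 g25 `STPPVosperCoverW342Asm.lean`.  Nothing here is progress on `ω`.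
-/

open Finset

namespace Summit.MatrixMultiplication.OmegaCensus.CubeNB

/-- The α₂ hypothesis (spec form) at `j = 30`: every admissible pair has an offset whose cover+words search fails. [folklore] -/
theorem specEK1_j30 : ∀ ℓ₁, 1 ≤ ℓ₁ → 2 * ℓ₁ ≤ 17 → ∀ t₁ < 61, ∀ t₂ < 61, (∀ i' < ℓ₁ + 1, (t₁ + 30 * i') % 61 < 42 + 1) →
    (∀ i' < 17 - ℓ₁ + 1, (t₂ + 30 * i') % 61 < 42 + 1) →
    #((range (ℓ₁ + 1)).image (fun i' => (t₁ + 30 * i') % 61) ∪ (range (17 - ℓ₁ + 1)).image (fun i' => (t₂ + 30 * i') % 61)) = 17 + 2 →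
    prefixOK 3 ((range (ℓ₁ + 1)).image (fun i' => (t₁ + 30 * i') % 61) ∪ (range (17 - ℓ₁ + 1)).image (fun i' => (t₂ + 30 * i') % 61)) = true →
    30 ∈ ({0, 1, 60, 2, 59} : Finset ℕ) ∨ coverA2E (blockDiffsWP 61) 61 17 16 [((2 : ℕ), (3 : ℕ), (4 : ℕ)), (3, 2, 2), (2, 1, 1)] [((3 : ℕ), (2 : ℕ), (4 : ℕ)), (2, 3, 2), (1, 2, 1)] false 30 ℓ₁ ((t₂ + 61 - t₁) % 61) = false := by
  intro ℓ₁ h1 h2 t₁ ht₁ t₂ ht₂ hw1 hw2 hcard hpre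
  right
  rw [coverA2E, if_neg (by decide)]
  have hℓ : ℓ₁ ≤ 8 := by omega
  interval_cases ℓ₁
  · rcases alpha2AdmOKd_spec admK1_j30_l1 t₁ ht₁ t₂ ht₂ hw1 hw2 hcard hpre with hJ | hD
    · exact absurd hJ (by decide)
    · exact ceK1_a_j30_l1 _ hD
  · rcases alpha2AdmOKd_spec admK1_j30_l2 t₁ ht₁ t₂ ht₂ hw1 hw2 hcard hpre with hJ | hD
    · exact absurd hJ (by decide)
    · exact ceK1_a_j30_l2 _ hD
  · rcases alpha2AdmOKd_spec admK1_j30_l3 t₁ ht₁ t₂ ht₂ hw1 hw2 hcard hpre with hJ | hD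
    · exact absurd hJ (by decide)
    · exact ceK1_a_j30_l3 _ hD
  · rcases alpha2AdmOKd_spec admK1_j30_l4 t₁ ht₁ t₂ ht₂ hw1 hw2 hcard hpre with hJ | hD
    · exact absurd hJ (by decide)
    · exact ceK1_a_j30_l4 _ hD
  · rcases alpha2AdmOKd_spec admK1_j30_l5 t₁ ht₁ t₂ ht₂ hw1 hw2 hcard hpre with hJ | hD
    · exact absurd hJ (by decide)
    · exact ceK1_a_j30_l5 _ hD
  · rcases alpha2AdmOKd_spec admK1_j30_l6 t₁ ht₁ t₂ ht₂ hw1 hw2 hcard hpre with hJ | hD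
    · exact absurd hJ (by decide)
    · exact ceK1_a_j30_l6 _ hD
  · rcases alpha2AdmOKd_spec admK1_j30_l7 t₁ ht₁ t₂ ht₂ hw1 hw2 hcard hpre with hJ | hD
    · exact absurd hJ (by decide)
    · exact ceK1_a_j30_l7 _ hD
  · rcases alpha2AdmOKd_spec admK1_j30_l8 t₁ ht₁ t₂ ht₂ hw1 hw2 hcard hpre with hJ | hD
    · exact absurd hJ (by decide)
    · exact ceK1_a_j30_l8 _ hD

/-- The α₂ hypothesis (spec form) at `j = 31`: every admissible pair has an offset whose cover+words search fails. [folklore] -/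
theorem specEK1_j31 : ∀ ℓ₁, 1 ≤ ℓ₁ → 2 * ℓ₁ ≤ 17 → ∀ t₁ < 61, ∀ t₂ < 61, (∀ i' < ℓ₁ + 1, (t₁ + 31 * i') % 61 < 42 + 1) →
    (∀ i' < 17 - ℓ₁ + 1, (t₂ + 31 * i') % 61 < 42 + 1) →
    #((range (ℓ₁ + 1)).image (fun i' => (t₁ + 31 * i') % 61) ∪ (range (17 - ℓ₁ + 1)).image (fun i' => (t₂ + 31 * i') % 61)) = 17 + 2 →
    prefixOK 3 ((range (ℓ₁ + 1)).image (fun i' => (t₁ + 31 * i') % 61) ∪ (range (17 - ℓ₁ + 1)).image (fun i' => (t₂ + 31 * i') % 61)) = true →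
    31 ∈ ({0, 1, 60, 2, 59} : Finset ℕ) ∨ coverA2E (blockDiffsWP 61) 61 17 16 [((2 : ℕ), (3 : ℕ), (4 : ℕ)), (3, 2, 2), (2, 1, 1)] [((3 : ℕ), (2 : ℕ), (4 : ℕ)), (2, 3, 2), (1, 2, 1)] false 31 ℓ₁ ((t₂ + 61 - t₁) % 61) = false := by
  intro ℓ₁ h1 h2 t₁ ht₁ t₂ ht₂ hw1 hw2 hcard hpre
  right
  rw [coverA2E, if_neg (by decide)]
  have hℓ : ℓ₁ ≤ 8 := by omega
  interval_cases ℓ₁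
  · rcases alpha2AdmOKd_spec admK1_j31_l1 t₁ ht₁ t₂ ht₂ hw1 hw2 hcard hpre with hJ | hD
    · exact absurd hJ (by decide)
    · exact ceK1_a_j31_l1 _ hD
  · rcases alpha2AdmOKd_spec admK1_j31_l2 t₁ ht₁ t₂ ht₂ hw1 hw2 hcard hpre with hJ | hD
    · exact absurd hJ (by decide)
    · exact ceK1_a_j31_l2 _ hD
  · rcases alpha2AdmOKd_spec admK1_j31_l3 t₁ ht₁ t₂ ht₂ hw1 hw2 hcard hpre with hJ | hD
    · exact absurd hJ (by decide)
    · exact ceK1_a_j31_l3 _ hD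
  · rcases alpha2AdmOKd_spec admK1_j31_l4 t₁ ht₁ t₂ ht₂ hw1 hw2 hcard hpre with hJ | hD
    · exact absurd hJ (by decide)
    · exact ceK1_a_j31_l4 _ hD
  · rcases alpha2AdmOKd_spec admK1_j31_l5 t₁ ht₁ t₂ ht₂ hw1 hw2 hcard hpre with hJ | hD
    · exact absurd hJ (by decide)
    · exact ceK1_a_j31_l5 _ hD
  · rcases alpha2AdmOKd_spec admK1_j31_l6 t₁ ht₁ t₂ ht₂ hw1 hw2 hcard hpre with hJ | hD
    · exact absurd hJ (by decide)
    · exact ceK1_a_j31_l6 _ hD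
  · rcases alpha2AdmOKd_spec admK1_j31_l7 t₁ ht₁ t₂ ht₂ hw1 hw2 hcard hpre with hJ | hD
    · exact absurd hJ (by decide)
    · exact ceK1_a_j31_l7 _ hD
  · rcases alpha2AdmOKd_spec admK1_j31_l8 t₁ ht₁ t₂ ht₂ hw1 hw2 hcard hpre with hJ | hD
    · exact absurd hJ (by decide)
    · exact ceK1_a_j31_l8 _ hD

/-- Every ratio other than `30, 31` is a word or has NO admissible offset. [folklore] -/
theorem admbulkK1 : ∀ j < 61, j = 30 ∨ j = 31 ∨ ∀ ℓ₁ < 9, ℓ₁ = 0 ∨ alpha2AdmOKd 61 43 17 3 ({0, 1, 60, 2, 59} : Finset ℕ) j ℓ₁ [] = true := by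
  decide +kernel

/-- **The α₂ hypothesis of the law (spec form)** for the reading `(2,3,4)` of K1 at `61`. [folklore] -/
theorem specEK1 : ∀ j < 61, ∀ ℓ₁, 1 ≤ ℓ₁ → 2 * ℓ₁ ≤ 17 → ∀ t₁ < 61, ∀ t₂ < 61, (∀ i' < ℓ₁ + 1, (t₁ + j * i') % 61 < 42 + 1) →
    (∀ i' < 17 - ℓ₁ + 1, (t₂ + j * i') % 61 < 42 + 1) →
    #((range (ℓ₁ + 1)).image (fun i' => (t₁ + j * i') % 61) ∪ (range (17 - ℓ₁ + 1)).image (fun i' => (t₂ + j * i') % 61)) = 17 + 2 →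
    prefixOK 3 ((range (ℓ₁ + 1)).image (fun i' => (t₁ + j * i') % 61) ∪ (range (17 - ℓ₁ + 1)).image (fun i' => (t₂ + j * i') % 61)) = true →
    j ∈ ({0, 1, 60, 2, 59} : Finset ℕ) ∨ coverA2E (blockDiffsWP 61) 61 17 16 [((2 : ℕ), (3 : ℕ), (4 : ℕ)), (3, 2, 2), (2, 1, 1)] [((3 : ℕ), (2 : ℕ), (4 : ℕ)), (2, 3, 2), (1, 2, 1)] false j ℓ₁ ((t₂ + 61 - t₁) % 61) = false := by
  intro j hj ℓ₁ h1 h2 t₁ ht₁ t₂ ht₂ hw1 hw2 hcard hpre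
  rcases admbulkK1 j hj with rfl | rfl | hall
  · exact specEK1_j30 ℓ₁ h1 h2 t₁ ht₁ t₂ ht₂ hw1 hw2 hcard hpre
  · exact specEK1_j31 ℓ₁ h1 h2 t₁ ht₁ t₂ ht₂ hw1 hw2 hcard hpre
  · rcases hall ℓ₁ (by omega) with h0 | hadm
    · omega
    · rcases alpha2AdmOKd_spec hadm t₁ ht₁ t₂ ht₂ hw1 hw2 hcard hpre with hJ | hD
      · exact Or.inl hJ
      · simp at hD

end Summit.MatrixMultiplication.OmegaCensus.CubeNB
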